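import Summits.BirchSwinnertonDyer.BirchSwinnertonDyer.Theses.ByReductionTypeAtTwo
import Summits.BirchSwinnertonDyer.Rank1Residual.Additive.QuadraticTwistBSDComparisonIsogeny
import Literature.GroupTheory.FiniteAbelian.SymplecticModules
import Literature.NumberTheory.EllipticCurves.BSDShaProofs
import HarnessLib

/-!
# K4 crux `AdditiveRankZeroAtTwo` (item 19098), child C3″ `AdditivePotGoodLowerHalfAtTwo` (item 22617):
# the ORDER-WITNESS road into the Eisenstein half — ONE element of `Ш` of order `p^j` certifies
# `p^{2j} ∣ #Ш` (Cassels–Tate makes `Ш ≅ L × L`), so the residue's `2⁴ ∣ #Ш_an` classes need ONE element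
# of order `4`, not a subgroup of order `8`

Cell `bsd-2adic`, seat `bsd-2adic-k4-w2` GEN 0; `--supports stmt-BirchSwinnertonDyer-22617 --as helper`.
HONEST FRAMING: conditional theorems (published inputs BY NAME + a per-class certificate SLOT the tree cannot fill
by itself — an explicit element of `Ш`, exhibited outside the kernel by a `2`-power descent); closes nothing at the
`∀`-level; nothing booked; BSD is not proved by any of this.

WHAT IS NEW. The cell's certificate roads into a typed lower half `MissingLowerBoundAt W p` (rung K9's
`missingLowerBoundAt_of_pow_dvd_of_casselsTate`, `cube_dvd_shaOrder_of_deepWitness` in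
`Theorems/KatoDescentPotSupersingularWildLowerSubgroupWitness.lean`; rung K8 (t′)'s class certificates) use the Cassels–Tate pairing only through the COROLLARY «`#Ш` is a square» (the rounding
`k ↦ k + (k mod 2)`): a deep certificate (`ord_p #Ш_an = 4`) then needs `p³ ∣ #Ш`, i.e. an element of order `p²`
AND an independent `p`-torsion element. The tree meanwhile PROVES the full structure theorem behind the corollary
(`Literature.GroupTheory.FiniteAbelian.exists_addEquiv_prod_self`: a finite abelian group with a nondegenerate
alternating `ℚ/ℤ`-pairing is `≃+ L × L`, Wall 1963 Lemma 7 / Tignol–Amitsur 1986 Thm. 4.1). §1 draws the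
consequence the rounding cannot see: **the square of the order of ANY element divides the order of the group**
(`sq_addOrderOf_dvd_natCard_of_alternating`) — so for `Ш(E/K)` finite, `(ord x)² ∣ #Ш(E/K)` for every `x ∈ Ш`
(`sq_addOrderOf_dvd_shaOrder_of_casselsTate`, §2), and ONE element of order `p^j` at a member `W'` with
`ord_p #Ш_an(W') ≤ 2j` gives the lower half along the whole isogeny class (§3, Cassels' transport). §4 keys this to
C3″: `AdditivePotGoodLowerHalfAtTwo` follows from GZK + modularity + Cassels + Cassels–Tate BY NAME and ONE
ORDER WITNESS PER CLASS (`additivePotGoodLowerHalfAtTwo_of_orderWitnesses`).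

CENSUS (numbers, cell tables of record, no new computation): the additive potentially-good rank-`0` residue
`N < 5·10⁵` (lane A `memos/ROUTE-L2-files/phi_census.tsv`, kit j239581) has 1 480 classes with
`ord₂ #Ш_an(E₁) = 4` on 1 392, `= 6` on 85, `= 8` on 3; on the `E[2]`-reducible block (210 classes, 440 members,
kit j306106) and the `C₂` block (100 classes, 138 members, kit j307312) the MINIMUM of `ord₂ #Ш_an` over the class
is `4` on 203 + 96 classes and `6` on 7 + 4 — no unit member anywhere (the unit-member road of §3 closes 0 residue
classes); and `dim_𝔽₂ Ш[2] = dim Sel₂ − dim E(ℚ)[2] = 2` on EVERY X5 member (two engines, CERT-SEL2-AB-X5ALL,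
6 643 / 6 643), so the predicted shape is `Ш[2^∞] ≅ (ℤ/2^{a/2})²` with `a = ord₂ #Ш_an` and the ORDER WITNESS (one
element of order `2^{a/2}`: order `4` on 1 392 classes) is exactly the certificate a `2^{a/2+1}`-descent delivers —
half of the cell's previous currency «`dim Sel₂ = t + 2 ∧ CT ≡ 0 ⇒ Ш[4] ≅ (ℤ/4)²`».

References: [Wall1963QuadraticFormsFiniteGroups] Lemma 7; [TignolAmitsur1986SymplecticModules] Thm. 4.1;
[SilvermanAEC2009] Thm. X.4.14; [Cassels1962ArithmeticIV]; [Cassels1965ArithmeticVIII] / [MilneADT2006] Thm. I.7.3;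
[Miller2011LMS] Def. 1.1; [GrossZagier1986], [Kolyvagin1990].
-/

set_option autoImplicit false
set_option linter.dupNamespace false

noncomputable section

open scoped Classical

/-! ## §1 Pure algebra: in a symplectic finite abelian group the square of every element order divides the
group order -/

namespace Literature.GroupTheory.FiniteAbelian

universe u

/-- **`(ord x)² ∣ #T` in a symplectic module.** For a finite abelian group `T` with a nondegenerate
alternating `ℚ/ℤ`-valued pairing and any `x ∈ T`, `(addOrderOf x)² ∣ #T`: by Wall / Tignol–Amitsur
`T ≃+ L × L` (`exists_addEquiv_prod_self`); the image `(a, b)` of `x` has order `lcm (ord a) (ord b)`, which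
divides `#L` (Lagrange for `a` and `b`), and `#T = (#L)²`. Sharper than «`#T` is a square» for certificate
purposes: an element of order `p^j` forces `p^{2j} ∣ #T`. [cite: Wall1963QuadraticFormsFiniteGroups, Lemma 7]
[cite: TignolAmitsur1986SymplecticModules, Thm. 4.1] -/
theorem sq_addOrderOf_dvd_natCard_of_alternating {T : Type u} [AddCommGroup T] [Finite T]
    (B : T →+ T →+ AddCircle (1 : ℚ)) (halt : ∀ x, B x x = 0) (hnd : ∀ x, (∀ y, B x y = 0) → x = 0)
    (x : T) : addOrderOf x ^ 2 ∣ Nat.card T := by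
  obtain ⟨L, -, ⟨e⟩⟩ := exists_addEquiv_prod_self B halt hnd
  have hx : addOrderOf x = (addOrderOf (e x).1).lcm (addOrderOf (e x).2) := by
    rw [← Prod.addOrderOf, AddEquiv.addOrderOf_eq]
  have hdvd : addOrderOf x ∣ Nat.card L := by
    rw [hx]
    exact Nat.lcm_dvd (addOrderOf_dvd_natCard _) (addOrderOf_dvd_natCard _)
  rw [Nat.card_congr e.toEquiv, Nat.card_prod, sq]
  exact Nat.mul_dvd_mul hdvd hdvd

/-- **Valuation form**: in a symplectic module, `2 · ord_p (ord x) ≤ ord_p #T` for every prime `p` and every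
`x`. [cite: Wall1963QuadraticFormsFiniteGroups, Lemma 7] -/
theorem two_mul_padicValNat_addOrderOf_le_of_alternating {T : Type u} [AddCommGroup T] [Finite T]
    (B : T →+ T →+ AddCircle (1 : ℚ)) (halt : ∀ x, B x x = 0) (hnd : ∀ x, (∀ y, B x y = 0) → x = 0)
    (p : ℕ) [hp : Fact p.Prime] (x : T) :
    2 * padicValNat p (addOrderOf x) ≤ padicValNat p (Nat.card T) := by
  have hcard : Nat.card T ≠ 0 := (Nat.card_pos (α := T)).ne'
  refine (padicValNat_dvd_iff_le hcard).mp ?_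
  -- `p ^ (2 * v) = (p ^ v)² ∣ (ord x)² ∣ #T` with `v = ord_p (ord x)`
  have h1 : (p ^ padicValNat p (addOrderOf x)) ^ 2 ∣ addOrderOf x ^ 2 :=
    pow_dvd_pow_of_dvd pow_padicValNat_dvd 2
  rw [← pow_mul, mul_comm] at h1
  exact h1.trans (sq_addOrderOf_dvd_natCard_of_alternating B halt hnd x)

end Literature.GroupTheory.FiniteAbelian

/-! ## §2 `Ш(E/K)`: the square of the order of every element divides `#Ш` (Cassels–Tate) -/

namespace WeierstrassCurve

open Literature.NumberTheory.EllipticCurves Literature.GroupTheory.FiniteAbelian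

universe u

variable {K : Type u} [Field K] [NumberField K]

/-- **`(ord x)² ∣ #Ш(E/K)` for every `x ∈ Ш(E/K)`, `Ш` finite** — from the Cassels–Tate pairing fact
`exists_casselsTate_pairing` (alternating, kernel = divisible elements; Silverman X.4.14): a finite group has no
nonzero divisible element (`divisibleElements_eq_bot_of_finite`), so the pairing is nondegenerate and §1 applies.
The printed corollary «`#Ш` is a square» is the case of no witness; this is its element-wise sharpening (an
element of order `p^j` gives `p^{2j} ∣ #Ш`). Conditional on `h` (the pairing fact).
[cite: SilvermanAEC2009, Thm. X.4.14] [cite: Wall1963QuadraticFormsFiniteGroups, Lemma 7] -/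
theorem sq_addOrderOf_dvd_card_sha_of_casselsTate (h : exists_casselsTate_pairing (K := K))
    (W : WeierstrassCurve K) [W.IsElliptic] [Finite W.sha] (x : W.sha) :
    addOrderOf x ^ 2 ∣ Nat.card W.sha := by
  obtain ⟨B, halt, hker⟩ := h W
  refine sq_addOrderOf_dvd_natCard_of_alternating B halt (fun a ha ↦ ?_) x
  have hmem : a ∈ AddSubgroup.divisibleElements W.sha := (hker a).mp ha
  rwa [divisibleElements_eq_bot_of_finite, AddSubgroup.mem_bot] at hmem

/-- **`(ord x)² ∣ shaOrder`** (`shaOrder = #Ш` as a natural number), finite `Ш`. Conditional on the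
Cassels–Tate fact `h`. [cite: SilvermanAEC2009, Thm. X.4.14] -/
theorem sq_addOrderOf_dvd_shaOrder_of_casselsTate (h : exists_casselsTate_pairing (K := K))
    (W : WeierstrassCurve K) [W.IsElliptic] [Finite W.sha] (x : W.sha) :
    addOrderOf x ^ 2 ∣ W.shaOrder := by
  rw [WeierstrassCurve.shaOrder]
  exact sq_addOrderOf_dvd_card_sha_of_casselsTate h W x

/-- **`2 · ord_p (ord x) ≤ ord_p #Ш(E/K)`** for every `x ∈ Ш(E/K)`, `Ш` finite, every prime `p`. Conditional on
the Cassels–Tate fact `h`. [cite: SilvermanAEC2009, Thm. X.4.14] -/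
theorem two_mul_padicValNat_addOrderOf_le_padicValNat_shaOrder_of_casselsTate
    (h : exists_casselsTate_pairing (K := K)) (W : WeierstrassCurve K) [W.IsElliptic] [Finite W.sha]
    (p : ℕ) [Fact p.Prime] (x : W.sha) :
    2 * padicValNat p (addOrderOf x) ≤ padicValNat p W.shaOrder := by
  obtain ⟨B, halt, hker⟩ := h W
  rw [WeierstrassCurve.shaOrder]
  refine two_mul_padicValNat_addOrderOf_le_of_alternating B halt (fun a ha ↦ ?_) p x
  have hmem : a ∈ AddSubgroup.divisibleElements W.sha := (hker a).mp ha
  rwa [divisibleElements_eq_bot_of_finite, AddSubgroup.mem_bot] at hmem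

/-- **An element of order `p^j` gives `p^{2j} ∣ #Ш`** (the form that feeds rung K9's divisibility slot
`p^k ∣ shaOrder` with `k = 2j`, no rounding and no second element needed). Conditional on the Cassels–Tate
fact `h`. [cite: SilvermanAEC2009, Thm. X.4.14] -/
theorem pow_two_mul_dvd_shaOrder_of_orderWitness_of_casselsTate (h : exists_casselsTate_pairing (K := K))
    (W : WeierstrassCurve K) [W.IsElliptic] [Finite W.sha] (p : ℕ) {j : ℕ} {x : W.sha}
    (hx : addOrderOf x = p ^ j) : p ^ (2 * j) ∣ W.shaOrder := by
  have hsq := sq_addOrderOf_dvd_shaOrder_of_casselsTate h W x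
  rwa [hx, ← pow_mul, mul_comm] at hsq

end WeierstrassCurve

/-! ## §3 The typed lower half at a pair from ONE order witness, and along the isogeny class -/

namespace Summit.BirchSwinnertonDyer.BirchSwinnertonDyer.Theorems

open WeierstrassCurve Literature.NumberTheory.EllipticCurves
  Literature.NumberTheory.EllipticCurves.Rank1Residual
  Literature.NumberTheory.EllipticCurves.Rank1Residual.Typed
  Summit.BirchSwinnertonDyer.Rank1Residual.Additive

section Pair

variable (W : WeierstrassCurve ℚ) [W.IsElliptic] (p : ℕ) [hp : Fact p.Prime]

/-- **`MissingLowerBoundAt W p` from ONE element of `Ш(W)`**: in analytic rank `≤ 1` (GZK `hGZK`: `Ш(W)`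
finite), if `#Ш_an(W) = q` with `ord_p q ≤ 2 · ord_p (ord x)` for some `x ∈ Ш(W)`, then
`ord_p #Ш_an(W) ≤ ord_p #Ш(W)` — §2 with the Cassels–Tate fact `hCT`. For `ord_p #Ш_an = 4` ONE element of
order `p²` suffices (rung K9's deep road needed an element of order `p²` AND an independent `p`-torsion element).
Conditional on `hCT`, `hGZK` and the certificate slot `x`. [cite: SilvermanAEC2009, Thm. X.4.14]
[cite: Miller2011LMS, Def. 1.1] -/
theorem missingLowerBoundAt_of_orderWitness_of_casselsTate (hCT : exists_casselsTate_pairing (K := ℚ))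
    (hGZK : rank_eq_analyticRank_of_analyticRank_le_one) (hr : W.analyticRank ≤ 1) {q : ℚ}
    (hq : shaAn W = (q : ℂ)) (x : W.sha)
    (hv : padicValRat p q ≤ ((2 * padicValNat p (addOrderOf x) : ℕ) : ℤ)) :
    MissingLowerBoundAt W p := by
  haveI : Finite W.sha := (hGZK W hr).2
  have hle := two_mul_padicValNat_addOrderOf_le_padicValNat_shaOrder_of_casselsTate hCT W p x
  exact ⟨q, hq, hv.trans (by exact_mod_cast hle)⟩

/-- **`MissingLowerBoundAt W p` from one element of order `p^j` with `ord_p #Ш_an(W) ≤ 2j`** (the same, with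
the witness in «order `= p^j`» form). Conditional on `hCT`, `hGZK` and the slot.
[cite: SilvermanAEC2009, Thm. X.4.14] [cite: Miller2011LMS, Def. 1.1] -/
theorem missingLowerBoundAt_of_orderWitness_pow_of_casselsTate (hCT : exists_casselsTate_pairing (K := ℚ))
    (hGZK : rank_eq_analyticRank_of_analyticRank_le_one) (hr : W.analyticRank ≤ 1) {q : ℚ}
    (hq : shaAn W = (q : ℂ)) {j : ℕ} {x : W.sha} (hx : addOrderOf x = p ^ j)
    (hv : padicValRat p q ≤ ((2 * j : ℕ) : ℤ)) : MissingLowerBoundAt W p := by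
  refine missingLowerBoundAt_of_orderWitness_of_casselsTate W p hCT hGZK hr hq x ?_
  rwa [hx, padicValNat.prime_pow]

omit hp in
/-- **The order-witness road FILLS rung K9's divisibility slot** `p^k ∣ shaOrder` with `k = 2j` (even, so the
Cassels–Tate rounding `k + (k mod 2)` of `KatoDescentPotSupersingularWildLowerSubgroupWitness` is idle): in analytic
rank `≤ 1` an element of order `p^j` gives the pair `(k, p^k ∣ #Ш(W)) = (2j, ✓)` — recorded so that K9's completeness
theorem (`…_iff_dvdWitnesses`, not imported here to keep this file off that route's cone) covers this road.
Conditional on `hCT`, `hGZK`. [cite: SilvermanAEC2009, Thm. X.4.14] -/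
theorem dvdSlot_of_orderWitness_pow_of_casselsTate (hCT : exists_casselsTate_pairing (K := ℚ))
    (hGZK : rank_eq_analyticRank_of_analyticRank_le_one) (hr : W.analyticRank ≤ 1) {j : ℕ} {x : W.sha}
    (hx : addOrderOf x = p ^ j) : ∃ k : ℕ, k = 2 * j ∧ k % 2 = 0 ∧ p ^ k ∣ W.shaOrder := by
  haveI : Finite W.sha := (hGZK W hr).2
  exact ⟨2 * j, rfl, Nat.mul_mod_right 2 j, pow_two_mul_dvd_shaOrder_of_orderWitness_of_casselsTate hCT W p hx⟩

end Pair

section Class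

variable (W : WeierstrassCurve ℚ) [W.IsElliptic] [W.IsGloballyMinimal] (p : ℕ) [hp : Fact p.Prime]

/-- **The lower half at EVERY member of a class ONE of whose members carries an order witness.** For `W`
globally minimal of analytic rank `≤ 1`: if SOME globally minimal `W' ∼_ℚ W` has `#Ш_an(W') = q'` and an
element `x' ∈ Ш(W')` with `ord_p q' ≤ 2 · ord_p (ord x')`, then `MissingLowerBoundAt W p` — §3 at `W'`, then
Cassels' transport of the typed lower half along the isogeny (`TwistComparison.missingLowerBoundAt_of_isIsogenous`:
Cassels `hCassels` + GZK `hGZK` + modularity `hmod`). Conditional on the four published facts and the slot.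
[cite: MilneADT2006, Thm. I.7.3] [cite: SilvermanAEC2009, Thm. X.4.14] [cite: Miller2011LMS, Def. 1.1] -/
theorem missingLowerBoundAt_of_isIsogenous_orderWitness (hCT : exists_casselsTate_pairing (K := ℚ))
    (hCassels : bsdRHS_eq_of_isIsogenous) (hGZK : rank_eq_analyticRank_of_analyticRank_le_one)
    (hmod : hasEntireLFunction_rat) (hr : W.analyticRank ≤ 1)
    (W' : WeierstrassCurve ℚ) [W'.IsElliptic] [W'.IsGloballyMinimal] (hiso : IsIsogenous W W')
    {q' : ℚ} (hq' : shaAn W' = (q' : ℂ)) (x' : W'.sha)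
    (hv' : padicValRat p q' ≤ ((2 * padicValNat p (addOrderOf x') : ℕ) : ℤ)) :
    MissingLowerBoundAt W p := by
  have hr' : W'.analyticRank ≤ 1 := by rwa [← analyticRank_eq_of_isIsogenous' hiso]
  exact TwistComparison.missingLowerBoundAt_of_isIsogenous W' W p hCassels hGZK hmod hiso.symm_of_charZero hr'
    (missingLowerBoundAt_of_orderWitness_of_casselsTate W' p hCT hGZK hr' hq' x' hv')

end Class

end Summit.BirchSwinnertonDyer.BirchSwinnertonDyer.Theorems

/-! ## §4 Keyed to C3″ `AdditivePotGoodLowerHalfAtTwo`: the crux from the published inputs and ONE ORDER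
WITNESS PER CLASS -/

namespace Summit.BirchSwinnertonDyer.BirchSwinnertonDyer.Theorems.AddKatoTwo

open WeierstrassCurve Literature.NumberTheory.EllipticCurves
  Literature.NumberTheory.EllipticCurves.Rank1Residual
  Literature.NumberTheory.EllipticCurves.Rank1Residual.Typed
  Summit.BirchSwinnertonDyer.BirchSwinnertonDyer.Theorems
  Summit.BirchSwinnertonDyer.BirchSwinnertonDyer.Theses.ByReductionTypeAtTwo

/-- **C3″ at `W` from one order witness in the class** (binders of the child verbatim: `W` globally minimal,
non-CM, analytic rank `0`, additive and potentially good at `2` — the reduction-type binders are carried for the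
record and not used): a globally minimal `W' ∼_ℚ W` with `#Ш_an(W') = q'` and `x' ∈ Ш(W')` with
`ord₂ q' ≤ 2 · ord₂ (ord x')` gives `MissingLowerBoundAt W 2`. On the census residue (`ord₂ #Ш_an = 4` at the
minimal member on 1 392 of 1 480 classes) the witness is ONE element of order `4` in `Ш(W')`. Conditional on
Cassels–Tate `hCT`, Cassels `hCassels`, GZK `hGZK`, modularity `hmod` and the slot.
[cite: SilvermanAEC2009, Thm. X.4.14] [cite: MilneADT2006, Thm. I.7.3] [cite: Miller2011LMS, Def. 1.1] -/
theorem addPotGoodLower_two_of_isIsogenous_orderWitness (hCT : exists_casselsTate_pairing (K := ℚ))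
    (hCassels : bsdRHS_eq_of_isIsogenous) (hGZK : rank_eq_analyticRank_of_analyticRank_le_one)
    (hmod : hasEntireLFunction_rat) (W : WeierstrassCurve ℚ) [W.IsElliptic] [W.IsGloballyMinimal]
    (_hcm : ¬ W.HasCM) (hr : W.analyticRank = 0) (_hadd : Addv W 2) (_hj : 0 ≤ padicValRat 2 W.j)
    (W' : WeierstrassCurve ℚ) [W'.IsElliptic] [W'.IsGloballyMinimal] (hiso : IsIsogenous W W')
    {q' : ℚ} (hq' : shaAn W' = (q' : ℂ)) (x' : W'.sha)
    (hv' : padicValRat 2 q' ≤ ((2 * padicValNat 2 (addOrderOf x') : ℕ) : ℤ)) :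
    MissingLowerBoundAt W 2 := by
  haveI : Fact (Nat.Prime 2) := ⟨Nat.prime_two⟩
  exact missingLowerBoundAt_of_isIsogenous_orderWitness W 2 hCT hCassels hGZK hmod (by rw [hr]; exact zero_le_one)
    W' hiso hq' x' hv'

/-- **C3″ at `W` from ONE element of order `4` in `Ш` at a member with `ord₂ #Ш_an ≤ 4`** — the shape of
1 392 of the 1 480 census residue classes (and, by `dim Ш[2] = 2` on every X5 member, the predicted
`Ш[2^∞] ≅ (ℤ/4)²` there). Conditional on the four published facts and the slot.
[cite: SilvermanAEC2009, Thm. X.4.14] [cite: MilneADT2006, Thm. I.7.3] [cite: Miller2011LMS, Def. 1.1] -/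
theorem addPotGoodLower_two_of_isIsogenous_orderFourWitness (hCT : exists_casselsTate_pairing (K := ℚ))
    (hCassels : bsdRHS_eq_of_isIsogenous) (hGZK : rank_eq_analyticRank_of_analyticRank_le_one)
    (hmod : hasEntireLFunction_rat) (W : WeierstrassCurve ℚ) [W.IsElliptic] [W.IsGloballyMinimal]
    (hcm : ¬ W.HasCM) (hr : W.analyticRank = 0) (hadd : Addv W 2) (hj : 0 ≤ padicValRat 2 W.j)
    (W' : WeierstrassCurve ℚ) [W'.IsElliptic] [W'.IsGloballyMinimal] (hiso : IsIsogenous W W')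
    {q' : ℚ} (hq' : shaAn W' = (q' : ℂ)) (hv' : padicValRat 2 q' ≤ 4) {x' : W'.sha}
    (hx' : addOrderOf x' = 4) : MissingLowerBoundAt W 2 := by
  refine addPotGoodLower_two_of_isIsogenous_orderWitness hCT hCassels hGZK hmod W hcm hr hadd hj W' hiso hq' x' ?_
  haveI : Fact (Nat.Prime 2) := ⟨Nat.prime_two⟩
  have h4 : padicValNat 2 (addOrderOf x') = 2 := by
    rw [hx', show (4 : ℕ) = 2 ^ 2 from rfl, padicValNat.prime_pow]
  rw [h4]; simpa using hv'

/-- **C3″ `AdditivePotGoodLowerHalfAtTwo` from Cassels–Tate, Cassels, GZK, modularity and ONE ORDER WITNESS PER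
CLASS.** `hwit`: for every globally minimal non-CM `W` of analytic rank `0`, additive and potentially good at `2`,
SOME globally minimal member `W'` of its isogeny class carries `#Ш_an(W') = q'` and an element `x' ∈ Ш(W')` with
`ord₂ q' ≤ 2 · ord₂ (ord x')`. This displays the residual of C3″ in certificate currency: one element of `Ш` of
order `2^{⌈a/2⌉}` (`a = ord₂ #Ш_an` at the minimal member; census: `a = 4` on 1 392, `6` on 85, `8` on 3 of 1 480
classes, no unit member on the reducible / `C₂` blocks). Class-wide, «every class has a witness» is NOT a theorem
of print — it is implied by the crux (BSD₂) only together with the cyclic-squared shape of `Ш[2^∞]`, and the tree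
cannot construct the witnesses; the item is NOT closed. Conditional on the four published facts and the slots.
[cite: SilvermanAEC2009, Thm. X.4.14] [cite: MilneADT2006, Thm. I.7.3] [cite: Miller2011LMS, Def. 1.1] -/
theorem additivePotGoodLowerHalfAtTwo_of_orderWitnesses (hCT : exists_casselsTate_pairing (K := ℚ))
    (hCassels : bsdRHS_eq_of_isIsogenous) (hGZK : rank_eq_analyticRank_of_analyticRank_le_one)
    (hmod : hasEntireLFunction_rat)
    (hwit : ∀ (W : WeierstrassCurve ℚ) [W.IsElliptic] [W.IsGloballyMinimal], ¬ W.HasCM → W.analyticRank = 0 →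
      Addv W 2 → 0 ≤ padicValRat 2 W.j →
      ∃ (W' : WeierstrassCurve ℚ) (_ : W'.IsElliptic) (_ : W'.IsGloballyMinimal), IsIsogenous W W' ∧
        ∃ (q' : ℚ) (x' : W'.sha), shaAn W' = (q' : ℂ) ∧
          padicValRat 2 q' ≤ ((2 * padicValNat 2 (addOrderOf x') : ℕ) : ℤ)) :
    AdditivePotGoodLowerHalfAtTwo := by
  intro W _ _ hcm hr hadd hj
  obtain ⟨W', hW'e, hW'm, hiso, q', x', hq', hv'⟩ := hwit W hcm hr hadd hj
  haveI := hW'e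
  haveI := hW'm
  exact addPotGoodLower_two_of_isIsogenous_orderWitness hCT hCassels hGZK hmod W hcm hr hadd hj W' hiso hq' x' hv'

/-- **Conversely, the crux hands back a DIVISIBILITY certificate on every row** (`2^k ∣ #Ш(W)` with
`ord₂ #Ш_an(W) ≤ k`, `k = ord₂ #Ш(W)` at the row itself) — recorded so that the reader sees which direction is
free: C3″ ⟹ K9's divisibility slot at every row (exact), whereas the ORDER witness of this file is a SUFFICIENT
certificate (sharper to exhibit, not implied back unless `Ш[2^∞]` is cyclic-squared). Pure bookkeeping
(`k = ord₂ shaOrder`, `2^k ∣ shaOrder` always). [cite: Miller2011LMS, Def. 1.1] -/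
theorem dvdWitness_of_additivePotGoodLowerHalfAtTwo (h : AdditivePotGoodLowerHalfAtTwo)
    (W : WeierstrassCurve ℚ) [W.IsElliptic] [W.IsGloballyMinimal]
    (hcm : ¬ W.HasCM) (hr : W.analyticRank = 0) (hadd : Addv W 2) (hj : 0 ≤ padicValRat 2 W.j) :
    ∃ (q : ℚ) (k : ℕ), shaAn W = (q : ℂ) ∧ padicValRat 2 q ≤ (k : ℤ) ∧ 2 ^ k ∣ W.shaOrder := by
  obtain ⟨q, hq, hle⟩ := h W hcm hr hadd hj
  exact ⟨q, padicValNat 2 W.shaOrder, hq, hle, pow_padicValNat_dvd⟩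

end Summit.BirchSwinnertonDyer.BirchSwinnertonDyer.Theorems.AddKatoTwo

end
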